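import Mathlib.Analysis.SpecialFunctions.BinaryEntropy
import Mathlib.Analysis.SpecialFunctions.Log.Deriv
import Mathlib.Analysis.Complex.ExponentialBounds
import Mathlib.NumberTheory.Divisors
import Mathlib.Data.Nat.Squarefree
import HarnessLib

/-!
# Goldbach–Linnik numbers: the closing numerical displays of Liu–Liu–Wang (1999: `K = 200` under GRH)

Topic `Literature/NumberTheory/Sieve`. Companion to `GoldbachLinnikLiCriteria.lean` (Li 2000 / Li 2001) and
`GoldbachLinnikHBPCriterion.lean` (Heath-Brown–Puchta 2002; Platt–Trudgian 2015; Liu–Lü 2011): one more row of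
the `K`-history of "every large even `N` is `p + p' +` (at most `K`) powers of two" read from the PRIMARY and its
closing ARITHMETIC checked by the kernel. **NOT a route to Goldbach; nothing here is new mathematics; GRH is neither
formalised nor asserted** — GRH enters Liu–Liu–Wang's paper only through the major arcs (their Theorem 2) and the
minor-arc bound `S(α) ≪ N^{3/4} log²N` (their Lemma 5), which are not objects of this file. The kernel certifies
the paper's printed NUMERICAL steps, with Chen's sieve constant `7.8342` (their Lemma 3 = Chen 1978, Thm 3), the
constant `1.8998`, Rosser–Schoenfeld's `e^γ < 1.7811` and Halberstam–Richert's `C₀ > 0.6601` taken exactly as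
printed (hypotheses), as the sibling files do.

J. Y. Liu, M. C. Liu, T. Z. Wang, *On the almost Goldbach problem of Linnik*, J. Théor. Nombres Bordeaux 11 (1999)
133–147 (read from the Numdam scan, page images):

* Theorem 1 (p. 134): "Assume the GRH. For any integer `k ≥ 200` there exists a positive constant `N_k` depending
  on `k` only, such that if `N ≥ N_k` is an even integer then `r_k(N) ≥ (1/42)·N log₂^k N / log² N`. In particular,
  each large even integer is a sum of two primes and 200 powers of 2."
* Lemma 2 (p. 140; "This is [LLW1, Lemma 3]" = Liu–Liu–Wang, Sci. China A 41 (1998) 386–398, Lemma 3): "Let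
  `η < 1/(7e)`. Then the set `𝓔` of `α ∈ (0,1]` for which `|G(α)| ≥ (1 − η)L` has measure `≤ L^{5/2} N^{Θ−1}`,
  where `Θ = Θ(η) = (1/log 2)·η csc²(π/8)·log(1/(η csc²(π/8))) + (1/log 2)·(1 − η csc²(π/8))·log(1/(1 − η csc²(π/8)))`"
  — i.e. `Θ(η) = H(η csc²(π/8))/log 2` with `H` the (natural) binary entropy and `csc²(π/8) = 4 + 2√2`
  (`llwTheta`, `llwTheta_eq_binEntropy`).
* p. 145: "Let `η = 0.0161` so that the definition of `Θ` in Lemma 2 gives `Θ < 0.4998 < 1/2`."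
  (`llw1999_theta_lt`: `Θ(0.0161) = 0.499727…`; the margin is `7·10⁻⁵`, and `0.0161` is the 4-decimal floor of the
  largest `η` with `Θ(η) < 1/2`, `η* = 0.016113…`.)
* Lemma 4 (p. 140): `∫₀¹ |S(α,N)G(α)|² dα ≤ (2/log²2)·C₀C₁N` with `C₁ < 24.4189`; its proof (pp. 141–143):
  `C₂ = 7.8342·∏_{p>2}(1 − 2/(p(p−1)))⁻¹`, "a straightforward computation gives `C₂ < 7.8342 × 1.8998`"; the table
  `c(x) ≤ 1, 4/3, 31/21, 183/105, 1.7752, 1.8228, 1.8307, 1.9248, 1.9405` (`x = 1,…,9`); `c(x) ≤ 1.4818 log x`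
  (`x ≥ 10`); "`C₃ ≤ ∑_{j≤9} c(j)∫_j^{j+1} x⁻² dx + 1.4818∫_{10}^∞ (log x)/x² dx ≤ 1.1160 + 1.4818(1 + log 10)/10
  < 1.6054`"; "`C₁ < C₂C₃ + log 2/(2C₀) + ε < 24.4189`" (`llw1999_cTable_sum_le`, `llw1999_C3_lt`, `llw1999_C1_lt`).
  The table itself is re-derived in the kernel (§2a): with `ρ(d) = m` stated arithmetically (`RhoEq`), the index sets
  `{d squarefree : ρ(d) = m}` for `m = 1,…,9` are `{1}, {3}, {7}, {5,15}, {31}, {21}, {127}, {17,51,85,255}, {73,511}`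
  (`llwDSet_vals`, `decide +kernel`), so `c(1..4) = 1, 4/3, 31/21, 183/105` exactly and `c(5..9) = 1926/1085, 5933/3255,
  756746/413385, 13526098/7027545, 995436634/513010785 ≤` the printed `1.7752, 1.8228, 1.8307, 1.9248, 1.9405`
  (`llwC_table`), and the weighted sum with the DEFINED `c` is `≤ 1.1160` (`llw1999_cTable_sum_le_defined`).
  The Euler product of (3.5) is bounded in the kernel too (§2b): for every finite set `S` of odd primes,
  `∏_{p∈S}(1 − 2/(p(p−1)))⁻¹ ≤ 1.8996` (`llw1999_eulerProduct_real_le`: the odd primes `≤ 100` by kernel evaluation,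
  head `≤ 1.8619619`, times the telescoping integer tail `∏_{100<n≤M} n(n−1)/((n+1)(n−2)) ≤ 101/99`), so the printed
  "`C₂ < 7.8342 × 1.8998`" holds for every partial product (`llw1999_C2_le`); the full product is `1.86878…`.
* Closing display (p. 146): "(4.5) `r_k(N) ≥ 2C₀(NL^k/log²N){1 − C₁(1−η)^{k−2} − 3ε}` if `k ≥ 2` and `N ≥ N_{k,ε}`.
  Also when `k ≥ 200` and `ε = 10⁻⁶`, one has `C₁(1−η)^{k−2} + 3ε < 0.9818`. Consequently if `k ≥ 200` and
  `N ≥ N_k`, then (4.5) becomes `r_k(N) ≥ 0.0240·NL^k/log²N`, on recalling that `C₀ > 0.6601`. This proves (1.3)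
  and hence Theorem 1." (`llw1999_decay_lt`, `llw1999_closing_display`, `llw1999_thm1_constant`; value at
  `k = 200`: `0.9817877…`, margin `1.2·10⁻⁵`.)

Observations recorded with the certificates (harness cell `pub-lg7`, COMPARATORS §26; none affects any theorem):
(i) the printed criterion already holds at `k = 199` (`24.4189·0.9839^{197} + 3·10⁻⁶ = 0.99785… < 1`,
`llw1999_display_at_199`) — Theorem 1's `k ≥ 200` buys the round constant `1/42`; (ii) the Euler product in `C₂`
equals `1.86878…` (partial products + the telescoping tail `∏_{n>N} n(n−1)/((n+1)(n−2)) = (N+1)/(N−1)`), so the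
printed `1.8998` is a valid but generous bound; (iii) Heath-Brown–Puchta (Asian J. Math. 6 (2002), §1) quote this
Lemma 2 as "`E(1−η) ≤ 1 − F((2+√2)η/4) − F(1 − (2+√2)η/4)`, `F(x) = x log x/log 2`" — the primary has
`csc²(π/8) = 4 + 2√2 = 8·(2+√2)/4` inside the entropy and the inequality as a LOWER bound for the exponent
`E = 1 − Θ`; the choice `η = 0.0161` (`Θ = 0.49973`) is consistent only with the primary's constant.

No named facts (`def … : Prop`) are introduced; `llwTheta` is an honest definition with the printed body.

## References

* J. Y. Liu, M. C. Liu, T. Z. Wang, *On the almost Goldbach problem of Linnik*, J. Théor. Nombres Bordeaux 11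
  (1999) 133–147: Theorem 1, Lemma 2, Lemma 4, §4 (4.5). [LiuLiuWang1999]
* D. R. Heath-Brown, J.-C. Puchta, *Integers represented as a sum of primes and powers of two*, Asian J. Math. 6
  (2002) 535–565, §1 (the comparison remark). [HeathbrownPuchta2002]
-/

noncomputable section

namespace Literature.NumberTheory.Sieve

namespace GoldbachLinnik

open Real Finset

/-! ### Elementary logarithm bounds (Taylor polynomial of `−log(1−x)` plus the geometric tail) -/

/-- `−log(1 − x) ≤ ∑_{i<n} x^{i+1}/(i+1) + x^{n+1}/(1 − x)` for `0 ≤ x < 1` (Mathlib's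
`Real.abs_log_sub_add_sum_range_le`, one-sided). [folklore] -/
theorem neg_log_one_sub_le_sum {x : ℝ} (hx0 : 0 ≤ x) (hx1 : x < 1) (n : ℕ) :
    -Real.log (1 - x) ≤ (∑ i ∈ range n, x ^ (i + 1) / (i + 1)) + x ^ (n + 1) / (1 - x) := by
  have hax : |x| < 1 := by rwa [abs_of_nonneg hx0]
  have h := Real.abs_log_sub_add_sum_range_le hax n
  rw [abs_of_nonneg hx0] at h
  have h' := (abs_le.mp h).1
  linarith

/-- `−log(1 − x) ≤ x + x²/2 + x³/3 + x⁴/4 + x⁵/5 + x⁶/(1 − x)` for `0 ≤ x < 1`. [folklore] -/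
theorem neg_log_one_sub_le_five {x : ℝ} (hx0 : 0 ≤ x) (hx1 : x < 1) :
    -Real.log (1 - x) ≤ x + x ^ 2 / 2 + x ^ 3 / 3 + x ^ 4 / 4 + x ^ 5 / 5 + x ^ 6 / (1 - x) := by
  have h := neg_log_one_sub_le_sum hx0 hx1 5
  simp only [sum_range_succ, sum_range_zero] at h
  norm_num at h
  linarith

/-- `−log(1 − x) ≤ x + x²/2 + ⋯ + x⁸/8 + x⁹/(1 − x)` for `0 ≤ x < 1`. [folklore] -/
theorem neg_log_one_sub_le_eight {x : ℝ} (hx0 : 0 ≤ x) (hx1 : x < 1) :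
    -Real.log (1 - x) ≤ x + x ^ 2 / 2 + x ^ 3 / 3 + x ^ 4 / 4 + x ^ 5 / 5 + x ^ 6 / 6 + x ^ 7 / 7
      + x ^ 8 / 8 + x ^ 9 / (1 - x) := by
  have h := neg_log_one_sub_le_sum hx0 hx1 8
  simp only [sum_range_succ, sum_range_zero] at h
  norm_num at h
  linarith

/-- `log 10 < 2.3026` (`log 10 = 3 log 2 + log(5/4) = 3 log 2 − log(1 − 1/5) = 2.3025850…`). [folklore] -/
theorem log_ten_lt : Real.log 10 < 2.3026 := by
  have h10 : Real.log 10 = Real.log 8 + Real.log (5 / 4) := by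
    rw [← Real.log_mul (by norm_num) (by norm_num)]; norm_num
  have h54 : Real.log (5 / 4) = -Real.log (1 - 1 / 5) := by
    rw [show (1 : ℝ) - 1 / 5 = (5 / 4)⁻¹ by norm_num, Real.log_inv, neg_neg]
  -- `log 8 = 3 log 2` (also in the tree as `FordLambda.log_8_eq`; inlined to keep this leaf's imports light)
  have h8 : Real.log 8 = 3 * Real.log 2 := by
    rw [show (8 : ℝ) = 2 ^ 3 by norm_num, Real.log_pow]; norm_num
  have hb := neg_log_one_sub_le_eight (show (0 : ℝ) ≤ 1 / 5 by norm_num) (by norm_num)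
  rw [h10, h8, h54]
  have hl2 := Real.log_two_lt_d9
  norm_num at hb ⊢
  linarith

/-! ### §1. Liu–Liu–Wang's exponent `Θ(η)` (Lemma 2) and the choice `η = 0.0161` -/

/-- Liu–Liu–Wang 1999, Lemma 2 (= Liu–Liu–Wang 1998 I, Lemma 3), the exponent, verbatim:
`Θ(η) = (1/log 2)·η csc²(π/8)·log(1/(η csc²(π/8))) + (1/log 2)·(1 − η csc²(π/8))·log(1/(1 − η csc²(π/8)))`
(the large-value set `{α : |G(α)| ≥ (1−η)L}` of `G(α) = ∑_{ν≤L} e(2^ν α)` has measure `≤ L^{5/2}N^{Θ(η)−1}` for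
`η < 1/(7e)`). Here `csc² = 1/sin²`. [cite: LiuLiuWang1999, Lemma 2 (p. 140)] -/
def llwTheta (η : ℝ) : ℝ :=
  (η / Real.sin (π / 8) ^ 2 * Real.log (η / Real.sin (π / 8) ^ 2)⁻¹
    + (1 - η / Real.sin (π / 8) ^ 2) * Real.log (1 - η / Real.sin (π / 8) ^ 2)⁻¹) / Real.log 2

/-- `√2 < 2`. [folklore] -/
theorem sqrt_two_lt_two : √(2 : ℝ) < 2 := (Real.sqrt_lt' (by norm_num)).mpr (by norm_num)

/-- `sin²(π/8) = (2 − √2)/4`. [folklore] -/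
theorem sin_pi_div_eight_sq : Real.sin (π / 8) ^ 2 = (2 - √2) / 4 := by
  rw [Real.sin_pi_div_eight, div_pow, Real.sq_sqrt (by linarith [sqrt_two_lt_two])]
  norm_num

/-- `csc²(π/8) = 1/sin²(π/8) = 4 + 2√2` (`= 6.8284…`). [folklore] -/
theorem inv_sin_pi_div_eight_sq : (Real.sin (π / 8) ^ 2)⁻¹ = 4 + 2 * √2 := by
  rw [sin_pi_div_eight_sq]
  have h2 : √(2 : ℝ) * √2 = 2 := Real.mul_self_sqrt (by norm_num)
  have hpos : (0 : ℝ) < 2 - √2 := by linarith [sqrt_two_lt_two]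
  rw [inv_div, div_eq_iff hpos.ne']
  nlinarith [h2]

/-- `Θ(η) = H(η·(4 + 2√2))/log 2` with `H(p) = p log(1/p) + (1−p) log(1/(1−p))` Mathlib's `Real.binEntropy`.
[cite: LiuLiuWang1999, Lemma 2 (p. 140)] -/
theorem llwTheta_eq_binEntropy (η : ℝ) :
    llwTheta η = Real.binEntropy (η * (4 + 2 * √2)) / Real.log 2 := by
  simp only [llwTheta, div_eq_mul_inv η, inv_sin_pi_div_eight_sq, Real.binEntropy]

/-- `1.41421356 < √2 < 1.41421357`. [folklore] -/
theorem sqrt_two_bounds : (1.41421356 : ℝ) < √2 ∧ √(2 : ℝ) < 1.41421357 :=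
  ⟨(Real.lt_sqrt (by norm_num)).mpr (by norm_num), (Real.sqrt_lt' (by norm_num)).mpr (by norm_num)⟩

/-- The argument of the entropy at `η = 0.0161`: `0 ≤ 0.0161·(4 + 2√2) ≤ 0.109938` (value `0.1099376…`).
[cite: LiuLiuWang1999, §4 (p. 145)] -/
theorem llw_arg_bounds :
    (0 : ℝ) ≤ 0.0161 * (4 + 2 * √2) ∧ (0.0161 : ℝ) * (4 + 2 * √2) ≤ 0.109938 := by
  constructor
  · positivity
  · nlinarith [sqrt_two_bounds.2]

/-- The decisive estimate: `H(0.109938) < 0.4998·log 2` (`H(0.109938) = 0.346385…`, `0.4998 log 2 = 0.346434…`),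
from `log(1/u) = 3 log 2 − log(8u) = 3 log 2 − log(1 − 0.120496)` and `log(1/(1−u)) = −log(1 − u)` with the
Taylor bounds above and `log 2 ∈ (0.6931471803, 0.6931471808)`. [cite: LiuLiuWang1999, §4 (p. 145)] -/
theorem binEntropy_llw_arg_lt : Real.binEntropy 0.109938 < 0.4998 * Real.log 2 := by
  have hU0 : (0 : ℝ) < 0.109938 := by norm_num
  have h1 : Real.log (0.109938 : ℝ)⁻¹ = 3 * Real.log 2 - Real.log (1 - 0.120496) := by
    have h8u : (1 : ℝ) - 0.120496 = 8 * 0.109938 := by norm_num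
    have h8 : Real.log 8 = 3 * Real.log 2 := by
      rw [show (8 : ℝ) = 2 ^ 3 by norm_num, Real.log_pow]; norm_num
    rw [h8u, Real.log_mul (by norm_num) hU0.ne', h8, Real.log_inv]
    ring
  have h2 : Real.log (1 - (0.109938 : ℝ))⁻¹ = -Real.log (1 - 0.109938) := Real.log_inv _
  have b1 := neg_log_one_sub_le_five (show (0 : ℝ) ≤ 0.120496 by norm_num) (by norm_num)
  have b2 := neg_log_one_sub_le_five (show (0 : ℝ) ≤ 0.109938 by norm_num) (by norm_num)
  have hl2hi := Real.log_two_lt_d9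
  have hl2lo := Real.log_two_gt_d9
  rw [Real.binEntropy, h1, h2]
  norm_num at b1 b2 ⊢
  nlinarith [b1, b2, hl2hi, hl2lo]

/-- **Liu–Liu–Wang 1999, p. 145 (as printed): "Let `η = 0.0161` so that the definition of `Θ` in Lemma 2 gives
`Θ < 0.4998`."** (`Θ(0.0161) = 0.499727…`.) [cite: LiuLiuWang1999, §4 (p. 145)] -/
theorem llw1999_theta_lt : llwTheta 0.0161 < 0.4998 := by
  rw [llwTheta_eq_binEntropy]
  have hlog2 : 0 < Real.log 2 := Real.log_pos (by norm_num)
  rw [div_lt_iff₀ hlog2]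
  obtain ⟨h0, hle⟩ := llw_arg_bounds
  have hmono := Real.binEntropy_strictMonoOn.monotoneOn
    (show (0.0161 : ℝ) * (4 + 2 * √2) ∈ Set.Icc (0 : ℝ) 2⁻¹ from ⟨h0, by linarith⟩)
    (show (0.109938 : ℝ) ∈ Set.Icc (0 : ℝ) 2⁻¹ by constructor <;> norm_num) hle
  exact lt_of_le_of_lt hmono binEntropy_llw_arg_lt

/-- "`Θ < 0.4998 < 1/2`" (p. 145): the exponent `Θ − 1 + 3/2` in (4.3) is then `< 1`, which is what the minor-arc
bound `∫_{C(𝓜)∩𝓔} ≪ N^{Θ−1}N^{3/2}L^{k+7} ≪ NL^{k−3}` uses. [cite: LiuLiuWang1999, §4 (4.3) (p. 145)] -/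
theorem llw1999_theta_lt_half : llwTheta 0.0161 < 1 / 2 :=
  lt_trans llw1999_theta_lt (by norm_num)

/-! ### §2. Lemma 4: `C₃ < 1.6054` and `C₁ < 24.4189` -/

/-- The printed table `c(x) ≤ 1, 4/3, 31/21, 183/105, 1.7752, 1.8228, 1.8307, 1.9248, 1.9405` (`x = 1,…,9`)
summed against `∫_j^{j+1} x⁻² dx = 1/j − 1/(j+1)`: `∑_{j≤9} c(j)(1/j − 1/(j+1)) ≤ 1.1160` (exact value with the
printed entries: `1.11593…`). The entries themselves (`c(x) = ∑_{m≤x} ∑_{ρ(d)=m} μ²(d)/d`, `ρ(d)` = the order of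
`2 mod d`: `d ∈ {1}, {3}, {7}, {5,15}, {31}, {21}, {127}, {17,51,85,255}, {73,511}`) are reproduced outside the
kernel and enter as printed. [cite: LiuLiuWang1999, Lemma 4, proof (pp. 142–143)] -/
theorem llw1999_cTable_sum_le :
    (1 : ℝ) * (1 / 1 - 1 / 2) + 4 / 3 * (1 / 2 - 1 / 3) + 31 / 21 * (1 / 3 - 1 / 4)
      + 183 / 105 * (1 / 4 - 1 / 5) + 1.7752 * (1 / 5 - 1 / 6) + 1.8228 * (1 / 6 - 1 / 7)
      + 1.8307 * (1 / 7 - 1 / 8) + 1.9248 * (1 / 8 - 1 / 9) + 1.9405 * (1 / 9 - 1 / 10) ≤ 1.1160 := by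
  norm_num

/-- **Liu–Liu–Wang 1999, Lemma 4 (as printed, p. 143): `1.1160 + 1.4818(1 + log 10)/10 < 1.6054`** (value
`1.605377…`; `1.4818∫_{10}^∞ (log x)/x² dx = 1.4818(1 + log 10)/10`). [cite: LiuLiuWang1999, Lemma 4, proof (p. 143)] -/
theorem llw1999_C3_lt : (1.1160 : ℝ) + 1.4818 * (1 + Real.log 10) / 10 < 1.6054 := by
  have h := log_ten_lt
  linarith

/-- **Liu–Liu–Wang 1999, Lemma 4 (as printed, p. 143): `C₁ < C₂C₃ + log 2/(2C₀) + ε < 24.4189`** from the printed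
`C₂ < 7.8342 × 1.8998` (p. 142; Chen's `7.8342` = Lemma 3 = Chen 1978 Thm 3, and `1.8998` for
`∏_{p>2}(1 − 2/(p(p−1)))⁻¹`), `C₃ < 1.6054`, `C₀ > 0.6601` ([HR, p. 128]) and a sufficiently small `ε`
(value without `ε`: `24.41886…`; any `ε ≤ 10⁻⁵` fits). The sieve input and the Euler product are NOT reproduced
in the kernel. [cite: LiuLiuWang1999, Lemma 4, proof (pp. 142–143)] -/
theorem llw1999_C1_lt {C₀ C₂ C₃ ε : ℝ} (hC₀ : 0.6601 ≤ C₀) (hC₂ : C₂ ≤ 7.8342 * 1.8998)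
    (hC₃ : C₃ ≤ 1.6054) (hC₃nn : 0 ≤ C₃) (hε : ε ≤ 1 / 10 ^ 5) :
    C₂ * C₃ + Real.log 2 / (2 * C₀) + ε < 24.4189 := by
  have hl2 := Real.log_two_lt_d9
  have hC₀pos : 0 < 2 * C₀ := by linarith
  have hquot : Real.log 2 / (2 * C₀) ≤ 0.6931471808 / 1.3202 := by
    rw [div_le_div_iff₀ hC₀pos (by norm_num)]
    nlinarith
  have hprod : C₂ * C₃ ≤ 7.8342 * 1.8998 * 1.6054 := by nlinarith
  norm_num at hquot hprod hε ⊢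
  linarith

/-! ### §2a. Lemma 4's table `c(x)` re-derived: the index sets `{d : μ²(d) = 1, ρ(d) = m}`, `m ≤ 9` -/

/-- Liu–Liu–Wang's `ρ(d)` ("for odd `d`, `ρ(d)` denotes the least integer `ρ ≥ 1` for which `2^ρ ≡ 1 (mod d)`")
equals `m`, stated arithmetically: `2^m ≡ 1 (mod d)` and no smaller positive exponent works (decidable).
[cite: LiuLiuWang1999, Lemma 4, proof (p. 142)] -/
def RhoEq (d m : ℕ) : Prop := 2 ^ m % d = 1 % d ∧ ∀ j < m, 0 < j → 2 ^ j % d ≠ 1 % d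

/-- `RhoEq d m` is decidable (a finite arithmetic check). [folklore] -/
instance (d m : ℕ) : Decidable (RhoEq d m) := by unfold RhoEq; infer_instance

/-- `ρ(d) = m` forces `d ∣ 2^m − 1`. [cite: LiuLiuWang1999, Lemma 4, proof (p. 142)] -/
theorem RhoEq.dvd {d m : ℕ} (h : RhoEq d m) : d ∣ 2 ^ m - 1 :=
  (Nat.modEq_iff_dvd' Nat.one_le_two_pow).mp h.1.symm

/-- The index set of the inner sum of `c(x)`: squarefree `d` with `ρ(d) = m` (all of them divide `2^m − 1`, so the
set is the filtered divisor set; `mem_llwDSet`). [cite: LiuLiuWang1999, Lemma 4, proof (p. 142)] -/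
def llwDSet (m : ℕ) : Finset ℕ := (Nat.divisors (2 ^ m - 1)).filter (fun d => Squarefree d ∧ RhoEq d m)

/-- For `m ≥ 1`: `d ∈ llwDSet m ↔ d` is squarefree and `ρ(d) = m` — no `d` is lost by filtering the divisors of
`2^m − 1`. [cite: LiuLiuWang1999, Lemma 4, proof (p. 142)] -/
theorem mem_llwDSet {m d : ℕ} (hm : 1 ≤ m) : d ∈ llwDSet m ↔ Squarefree d ∧ RhoEq d m := by
  unfold llwDSet
  rw [Finset.mem_filter, Nat.mem_divisors]
  constructor
  · exact fun h => h.2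
  · intro h
    refine ⟨⟨h.2.dvd, ?_⟩, h⟩
    have : 2 ≤ 2 ^ m := by
      calc (2 : ℕ) = 2 ^ 1 := by norm_num
        _ ≤ 2 ^ m := Nat.pow_le_pow_right (by norm_num) hm
    omega

/-- Liu–Liu–Wang's `c(x) = ∑_{m ≤ x} ∑_{ρ(d) = m} μ²(d)/d` (p. 142), with the inner index set `llwDSet m`.
[cite: LiuLiuWang1999, Lemma 4, proof (p. 142)] -/
def llwC (x : ℕ) : ℚ := ∑ m ∈ Finset.Icc 1 x, ∑ d ∈ llwDSet m, (1 : ℚ) / d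

/-- The nine index sets, by kernel evaluation: `{1}, {3}, {7}, {5, 15}, {31}, {21}, {127}, {17, 51, 85, 255},
{73, 511}` (`63 = 3²·7` contributes only `21`; `9`, `63` are not squarefree). [cite: LiuLiuWang1999, Lemma 4, proof (p. 142)] -/
theorem llwDSet_vals : llwDSet 1 = {1} ∧ llwDSet 2 = {3} ∧ llwDSet 3 = {7} ∧ llwDSet 4 = {5, 15} ∧
    llwDSet 5 = {31} ∧ llwDSet 6 = {21} ∧ llwDSet 7 = {127} ∧ llwDSet 8 = {17, 51, 85, 255} ∧
    llwDSet 9 = {73, 511} := by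
  refine ⟨?_, ?_, ?_, ?_, ?_, ?_, ?_, ?_, ?_⟩ <;> decide +kernel

/-- `c(9) = 995436634/513010785 (= 1.94038…)` exactly. [cite: LiuLiuWang1999, Lemma 4, proof (p. 142)] -/
theorem llwC_nine : llwC 9 = 995436634 / 513010785 := by
  decide +kernel

/-- **Liu–Liu–Wang 1999, the table of `c(x)` (as printed, p. 142), now a theorem:** `c(1) = 1`, `c(2) = 4/3`,
`c(3) = 31/21`, `c(4) = 183/105` exactly, and `c(5) ≤ 1.7752`, `c(6) ≤ 1.8228`, `c(7) ≤ 1.8307`, `c(8) ≤ 1.9248`,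
`c(9) ≤ 1.9405` (exact values `1926/1085, 5933/3255, 756746/413385, 13526098/7027545, 995436634/513010785`).
[cite: LiuLiuWang1999, Lemma 4, proof (p. 142)] -/
theorem llwC_table : llwC 1 = 1 ∧ llwC 2 = 4 / 3 ∧ llwC 3 = 31 / 21 ∧ llwC 4 = 183 / 105 ∧
    llwC 5 ≤ 1.7752 ∧ llwC 6 ≤ 1.8228 ∧ llwC 7 ≤ 1.8307 ∧ llwC 8 ≤ 1.9248 ∧ llwC 9 ≤ 1.9405 := by
  refine ⟨?_, ?_, ?_, ?_, ?_, ?_, ?_, ?_, ?_⟩ <;> decide +kernel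

/-- The weighted sum of p. 143 with the DEFINED `c`: `∑_{j ≤ 9} c(j)(1/j − 1/(j+1)) ≤ 1.1160` (exact value
`8587272854/7695161775 = 1.11593…`). [cite: LiuLiuWang1999, Lemma 4, proof (p. 143)] -/
theorem llw1999_cTable_sum_le_defined :
    ∑ j ∈ Finset.Icc 1 9, llwC j * (1 / (j : ℚ) - 1 / (j + 1)) ≤ 1.1160 := by
  decide +kernel

/-! ### §2b. The Euler product of (3.5): `∏_{p ∈ S}(1 − 2/(p(p−1)))⁻¹ ≤ 1.8996 < 1.8998` for every finite set `S` of odd primes -/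

/-- The factor `(1 − 2/(n(n−1)))⁻¹ = n(n−1)/((n+1)(n−2))` of the product in (3.5), over `ℚ`.
[cite: LiuLiuWang1999, Lemma 4, proof, (3.5) (p. 141)] -/
def llwEulerFac (n : ℕ) : ℚ := ((n : ℚ) * (n - 1)) / ((n + 1) * (n - 2))

/-- Each factor is `≥ 1` (`n ≥ 3`). [folklore] -/
theorem one_le_llwEulerFac {n : ℕ} (hn : 3 ≤ n) : 1 ≤ llwEulerFac n := by
  unfold llwEulerFac
  have hn' : (3 : ℚ) ≤ n := by exact_mod_cast hn
  rw [le_div_iff₀ (by nlinarith)]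
  nlinarith

/-- Telescoping: `∏_{N < n ≤ M} n(n−1)/((n+1)(n−2)) = (N+1)(M−1)/((M+1)(N−1))` for `3 ≤ N ≤ M`. [folklore] -/
theorem prod_Ioc_llwEulerFac {N : ℕ} (hN : 3 ≤ N) : ∀ {M : ℕ}, N ≤ M →
    ∏ n ∈ Finset.Ioc N M, llwEulerFac n = ((N + 1 : ℚ) * (M - 1)) / ((M + 1) * (N - 1)) := by
  intro M hM
  induction M, hM using Nat.le_induction with
  | base =>
    have hN' : (3 : ℚ) ≤ N := by exact_mod_cast hN
    rw [Finset.Ioc_self, Finset.prod_empty, eq_comm, div_eq_one_iff_eq (by nlinarith)]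
  | succ M hNM ih =>
    have hN' : (3 : ℚ) ≤ N := by exact_mod_cast hN
    have hM' : (N : ℚ) ≤ M := by exact_mod_cast hNM
    rw [← Finset.insert_Ioc_right_eq_Ioc_add_one hNM, Finset.prod_insert (by simp), ih]
    unfold llwEulerFac
    push_cast
    have h1 : (M : ℚ) - 1 ≠ 0 := by linarith
    have h2 : (M : ℚ) + 1 ≠ 0 := by linarith
    have h3 : (M : ℚ) + 1 + 1 ≠ 0 := by linarith
    have h4 : (M : ℚ) + 1 - 2 ≠ 0 := by linarith
    have h5 : (N : ℚ) - 1 ≠ 0 := by linarith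
    have h6 : (M : ℚ) + 1 - 1 ≠ 0 := by linarith
    field_simp
    ring

/-- The integer tail of the product is `≤ (N+1)/(N−1)`. [folklore] -/
theorem prod_Ioc_llwEulerFac_le {N M : ℕ} (hN : 3 ≤ N) (hM : N ≤ M) :
    ∏ n ∈ Finset.Ioc N M, llwEulerFac n ≤ (N + 1 : ℚ) / (N - 1) := by
  rw [prod_Ioc_llwEulerFac hN hM]
  have hN' : (3 : ℚ) ≤ N := by exact_mod_cast hN
  have hM' : (N : ℚ) ≤ M := by exact_mod_cast hM
  rw [div_le_div_iff₀ (by nlinarith) (by nlinarith)]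
  nlinarith

/-- A product of rational factors `≥ 1` is `≥ 1` (by induction; `ℚ` is not an ordered monoid under `*`). [folklore] -/
theorem one_le_prod_rat_of_one_le {s : Finset ℕ} {f : ℕ → ℚ} (h : ∀ i ∈ s, 1 ≤ f i) :
    1 ≤ ∏ i ∈ s, f i := by
  induction s using Finset.induction_on with
  | empty => simp
  | insert a s ha ih =>
    rw [Finset.prod_insert ha]
    have h1 : 1 ≤ f a := h a (Finset.mem_insert_self a s)
    have h2 : 1 ≤ ∏ i ∈ s, f i := ih (fun i hi => h i (Finset.mem_insert_of_mem hi))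
    nlinarith

/-- A sub-product of rational factors `≥ 1` is at most the full product. [folklore] -/
theorem prod_rat_le_prod_of_subset {s t : Finset ℕ} (hst : s ⊆ t) {f : ℕ → ℚ} (h : ∀ i ∈ t, 1 ≤ f i) :
    ∏ i ∈ s, f i ≤ ∏ i ∈ t, f i := by
  rw [← Finset.prod_sdiff hst]
  have h1 : 1 ≤ ∏ i ∈ t \ s, f i := one_le_prod_rat_of_one_le (fun i hi => h i (Finset.mem_sdiff.mp hi).1)
  have h2 : 0 ≤ ∏ i ∈ s, f i :=
    le_trans zero_le_one (one_le_prod_rat_of_one_le (fun i hi => h i (hst hi)))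
  nlinarith

/-- The odd primes `≤ 100`, by kernel evaluation. [folklore] -/
theorem oddPrimes_le_hundred : (Finset.range 101).filter (fun p => Nat.Prime p ∧ 2 < p) =
    {3, 5, 7, 11, 13, 17, 19, 23, 29, 31, 37, 41, 43, 47, 53, 59, 61, 67, 71, 73, 79, 83, 89, 97} := by
  decide +kernel

/-- The head of the product: `∏_{2 < p ≤ 100} p(p−1)/((p+1)(p−2)) ≤ 1.8619619` (exact value `1.86196184…`).
[cite: LiuLiuWang1999, Lemma 4, proof, (3.5) (p. 142)] -/
theorem llwEuler_head_le :
    ∏ p ∈ (Finset.range 101).filter (fun p => Nat.Prime p ∧ 2 < p), llwEulerFac p ≤ 18619619 / 10000000 := by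
  rw [oddPrimes_le_hundred]
  decide +kernel

/-- **For every finite set `S` of odd primes, `∏_{p ∈ S} p(p−1)/((p+1)(p−2)) ≤ 1.8996`** (head over the odd primes
`≤ 100`, tail by the telescoping bound `101/99` over ALL integers in `(100, max S]`; the full Euler product is
`1.86878…`, and `1.86196 × 101/99 = 1.89958`). [cite: LiuLiuWang1999, Lemma 4, proof, (3.5) and "C₂ < 7.8342 × 1.8998" (pp. 141–142)] -/
theorem llw1999_eulerProduct_le (S : Finset ℕ) (hS : ∀ p ∈ S, Nat.Prime p ∧ 2 < p) :
    ∏ p ∈ S, llwEulerFac p ≤ 1.8996 := by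
  have h3 : ∀ p ∈ S, 3 ≤ p := fun p hp => (hS p hp).2
  set S₁ := S.filter (fun p => p ≤ 100) with hS₁
  set S₂ := S.filter (fun p => ¬ p ≤ 100) with hS₂
  have hsplit : ∏ p ∈ S, llwEulerFac p = (∏ p ∈ S₁, llwEulerFac p) * ∏ p ∈ S₂, llwEulerFac p :=
    (Finset.prod_filter_mul_prod_filter_not S (fun p => p ≤ 100) _).symm
  have hsub₁ : S₁ ⊆ (Finset.range 101).filter (fun p => Nat.Prime p ∧ 2 < p) := by
    intro p hp
    rw [hS₁, Finset.mem_filter] at hp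
    exact Finset.mem_filter.mpr ⟨Finset.mem_range.mpr (by omega), hS p hp.1⟩
  have hT : ∀ p ∈ (Finset.range 101).filter (fun p => Nat.Prime p ∧ 2 < p), 1 ≤ llwEulerFac p :=
    fun p hp => one_le_llwEulerFac (Finset.mem_filter.mp hp).2.2
  have hhead : ∏ p ∈ S₁, llwEulerFac p ≤ 18619619 / 10000000 :=
    le_trans (prod_rat_le_prod_of_subset hsub₁ hT) llwEuler_head_le
  set M := S.sup id ⊔ 100 with hMdef
  have hsub₂ : S₂ ⊆ Finset.Ioc 100 M := by
    intro p hp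
    rw [hS₂, Finset.mem_filter] at hp
    have : p ≤ S.sup id := Finset.le_sup (f := id) hp.1
    exact Finset.mem_Ioc.mpr ⟨by omega, le_trans this le_sup_left⟩
  have hIoc : ∀ n ∈ Finset.Ioc 100 M, 1 ≤ llwEulerFac n := fun n hn => one_le_llwEulerFac (by
    have := (Finset.mem_Ioc.mp hn).1; omega)
  have htail : ∏ p ∈ S₂, llwEulerFac p ≤ (100 + 1 : ℚ) / (100 - 1) :=
    le_trans (prod_rat_le_prod_of_subset hsub₂ hIoc)
      (by exact_mod_cast prod_Ioc_llwEulerFac_le (N := 100) (M := M) (by norm_num) le_sup_right)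
  have h2pos : 0 ≤ ∏ p ∈ S₂, llwEulerFac p :=
    le_trans zero_le_one (one_le_prod_rat_of_one_le fun p hp => one_le_llwEulerFac (h3 p (Finset.mem_filter.mp hp).1))
  rw [hsplit]
  calc (∏ p ∈ S₁, llwEulerFac p) * ∏ p ∈ S₂, llwEulerFac p
      ≤ (18619619 / 10000000 : ℚ) * ((100 + 1) / (100 - 1)) := mul_le_mul hhead htail h2pos (by norm_num)
    _ ≤ 1.8996 := by norm_num

/-- The printed factor equals the rational one: `(1 − 2/(p(p−1)))⁻¹ = p(p−1)/((p+1)(p−2))` in `ℝ` for `p ≥ 3`.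
[cite: LiuLiuWang1999, Lemma 4, proof, (3.5) (p. 141)] -/
theorem inv_one_sub_eq_cast_llwEulerFac {p : ℕ} (hp : 3 ≤ p) :
    (1 - 2 / ((p : ℝ) * (p - 1)))⁻¹ = ((llwEulerFac p : ℚ) : ℝ) := by
  have hp' : (3 : ℝ) ≤ p := by exact_mod_cast hp
  have h1 : (p : ℝ) ≠ 0 := by positivity
  have h2 : (p : ℝ) - 1 ≠ 0 := by linarith
  have h3 : (p : ℝ) + 1 ≠ 0 := by linarith
  have h4 : (p : ℝ) - 2 ≠ 0 := by linarith
  have key : 1 - 2 / ((p : ℝ) * (p - 1)) = ((p + 1) * (p - 2)) / (p * (p - 1)) := by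
    field_simp
    ring
  rw [key, inv_div]
  unfold llwEulerFac
  push_cast
  rfl

/-- **The Euler product of (3.5), as printed, for every finite set `S` of odd primes:
`∏_{p ∈ S}(1 − 2/(p(p−1)))⁻¹ ≤ 1.8996`.** [cite: LiuLiuWang1999, Lemma 4, proof, (3.5) (pp. 141–142)] -/
theorem llw1999_eulerProduct_real_le (S : Finset ℕ) (hS : ∀ p ∈ S, Nat.Prime p ∧ 2 < p) :
    ∏ p ∈ S, (1 - 2 / ((p : ℝ) * (p - 1)))⁻¹ ≤ 1.8996 := by
  rw [Finset.prod_congr rfl (fun p hp => inv_one_sub_eq_cast_llwEulerFac (hS p hp).2)]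
  have h := llw1999_eulerProduct_le S hS
  have : ((∏ p ∈ S, llwEulerFac p : ℚ) : ℝ) ≤ ((1.8996 : ℚ) : ℝ) := by exact_mod_cast h
  push_cast at this
  simpa using this

/-- **Liu–Liu–Wang's "`C₂ < 7.8342 × 1.8998`" (p. 142) holds for every partial product of (3.5):**
`7.8342·∏_{p ∈ S}(1 − 2/(p(p−1)))⁻¹ ≤ 7.8342 × 1.8998` for every finite set `S` of odd primes — the binder
`hC₂` of `llw1999_C1_lt` is thereby met by every truncation of `C₂` (Chen's `7.8342` itself stays print).
[cite: LiuLiuWang1999, Lemma 4, proof (p. 142)] -/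
theorem llw1999_C2_le (S : Finset ℕ) (hS : ∀ p ∈ S, Nat.Prime p ∧ 2 < p) :
    7.8342 * ∏ p ∈ S, (1 - 2 / ((p : ℝ) * (p - 1)))⁻¹ ≤ 7.8342 * 1.8998 := by
  have h := llw1999_eulerProduct_real_le S hS
  nlinarith

/-! ### §3. The closing display (4.5) and Theorem 1's constant -/

/-- **Liu–Liu–Wang 1999, p. 146 (as printed), at `k = 200`: `24.4189·(1 − 0.0161)^{198} + 3·10⁻⁶ < 0.9818`**
(value `0.98178776…`, margin `1.2·10⁻⁵`). [cite: LiuLiuWang1999, §4, after (4.5) (p. 146)] -/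
theorem llw1999_decay_lt : (24.4189 : ℝ) * (1 - 0.0161) ^ 198 + 3 / 10 ^ 6 < 0.9818 := by
  norm_num

/-- **Liu–Liu–Wang 1999, closing display (as printed, p. 146): "when `k ≥ 200` and `ε = 10⁻⁶`, one has
`C₁(1−η)^{k−2} + 3ε < 0.9818`"** for every `C₁ ≤ 24.4189` (Lemma 4) with `η = 0.0161`.
[cite: LiuLiuWang1999, §4, after (4.5) (p. 146)] -/
theorem llw1999_closing_display {k : ℕ} (hk : 200 ≤ k) {C₁ : ℝ} (hC₁ : C₁ ≤ 24.4189) :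
    C₁ * (1 - 0.0161) ^ (k - 2) + 3 * (1 / 10 ^ 6 : ℝ) < 0.9818 := by
  have hq0 : (0 : ℝ) ≤ 1 - 0.0161 := by norm_num
  have hq1 : (1 : ℝ) - 0.0161 ≤ 1 := by norm_num
  have hpow : ((1 : ℝ) - 0.0161) ^ (k - 2) ≤ (1 - 0.0161) ^ 198 :=
    pow_le_pow_of_le_one hq0 hq1 (by omega)
  have hnn : (0 : ℝ) ≤ (1 - 0.0161) ^ (k - 2) := pow_nonneg hq0 _
  have h1 : C₁ * (1 - 0.0161) ^ (k - 2) ≤ 24.4189 * (1 - 0.0161) ^ (k - 2) :=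
    mul_le_mul_of_nonneg_right hC₁ hnn
  have h2 : (24.4189 : ℝ) * (1 - 0.0161) ^ (k - 2) ≤ 24.4189 * (1 - 0.0161) ^ 198 :=
    mul_le_mul_of_nonneg_left hpow (by norm_num)
  have h3 := llw1999_decay_lt
  generalize ((1 : ℝ) - 0.0161) ^ (k - 2) = s at h1 h2 hnn ⊢
  generalize ((1 : ℝ) - 0.0161) ^ 198 = t at h2 h3 ⊢
  linarith

/-- **Liu–Liu–Wang 1999, p. 146 / Theorem 1 (1.3) (as printed):** with `C₀ > 0.6601` and the bracket `< 0.9818`,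
`2C₀{1 − C₁(1−η)^{k−2} − 3ε} > 2·0.6601·(1 − 0.9818) ≥ 0.0240 ≥ 1/42`. [cite: LiuLiuWang1999, §4 (p. 146); Theorem 1 (1.3) (p. 134)] -/
theorem llw1999_thm1_constant {C₀ v : ℝ} (hC₀ : 0.6601 ≤ C₀) (hv : v < 0.9818) :
    (0.0240 : ℝ) < 2 * C₀ * (1 - v) ∧ (1 : ℝ) / 42 ≤ 0.0240 := by
  constructor
  · nlinarith
  · norm_num

/-- Observation (NOT in print): the printed criterion `C₁(1−η)^{k−2} + 3ε < 1` with `C₁ = 24.4189`, `η = 0.0161`,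
`ε = 10⁻⁶` already holds at `k = 199` (`24.4189·0.9839^{197} + 3·10⁻⁶ = 0.997853… < 1`), so (4.5) gives
`r_k(N) > 0` for `k ≥ 199`; Theorem 1's `k ≥ 200` secures the round constant `1/42`. [folklore] -/
theorem llw1999_display_at_199 : (24.4189 : ℝ) * (1 - 0.0161) ^ 197 + 3 / 10 ^ 6 < 1 := by
  norm_num

end GoldbachLinnik

end Literature.NumberTheory.Sieve
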